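import Mathlib

/-!
# Kernel certificate: the algebraic special point of the D₄ Shimura curve — (M1), (M3), (M4) of the vocabulary line INBOX l.712
(P2-D4TripleReading, the Shimura-curve reading; seat p2 (g5), pub-hodge-repro0) on the abstract D₄ configuration.

`D₄ = ⟨r, s⟩` acts on the four embeddings `c₀, c₁, c₂, c₃` of `K = F^⟨s⟩` (`r = (c₀ c₁ c₂ c₃)`, `s = (c₁ c₃)`, `ι = r²`); an embedding of `F`
is an element `g` of `D₄`; `g|_K ↔ g⟨s⟩` (the point `g·c₀`), `g|_{K*} ↔ g⟨rs⟩` (`K* = F^⟨rs⟩`); complex conjugation is post-composition by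
`ι`. `Φ = {c₀, c₁}`, `Φ* = {⟨rs⟩, s⟨rs⟩}` (the reflex type, `P2D4SpinWeights.reflex_type`), `rΦ* = {r⟨rs⟩, rs⟨rs⟩}` (the type of `A′*`).
Certified by `decide`:
* `M1_signature`: `B₀ = A* × A*` with `K` acting through `F` has K-signature `(2, 1, 0, 1)`: over the coset `x = g⟨s⟩` the number of
  `g ∈ x` with `g⟨rs⟩ ∈ Φ*` is `2, 1, 0, 1` for `x = c₀, c₁, c₂, c₃` — equal to the K-signature `|Φ ∩ x| + |Φ′ ∩ x|` of `A × A′`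
  (`Φ′ = {c₀, c₃}`);
* `M4_conjugate`: `A′* × A′*` (type `rΦ*`) has K-signature `(1, 2, 1, 0)` — the conjugate curve (`H^{2,0}` over `c₁`);
* `M3_types`: the CM types `Ψ ⊂ D₄` (4 elements, no `ι`-pair) with multiplicities `(2, 1, 0, 1)` over the cosets of `⟨s⟩` are EXACTLY
  `Ψ₂ = {e, s, rs, r³} = ⟨rs⟩ ∪ s⟨rs⟩` (induced from `(K*, Φ*)`) and `Ψ₁ = {e, s, r, r³s} = ⟨r³s⟩ ∪ s⟨r³s⟩` (induced from the conjugate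
  subfield `F^⟨r³s⟩`), and `Ψ₁ · s = Ψ₂` (right translation: the `F`-action twisted by `s`);
* `M3_transport`: the field isomorphism `r : F^⟨r³s⟩ → K*` carries the type `{⟨r³s⟩, s⟨r³s⟩}` to `Φ*` by pre-composition
  (`g⟨r³s⟩ ↦ g r⁻¹⟨rs⟩`): `r⁻¹⟨rs⟩ = s⟨rs⟩`, `s r⁻¹⟨rs⟩ = ⟨rs⟩` — so `A(F, Ψ₁) ∼ A(F, Ψ₂) ∼ A* × A*`: every CM-by-`F` point of the
  signature-`((2,0),(1,1))` curve is `B₀`.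
-/

namespace HodgeRepro0.P2D4ShimuraPoint

/-- a permutation of `0..3` given as the list of its values -/
def ap (t : List Nat) (x : Nat) : Nat := t.getD x x

/-- composition `s ∘ t` -/
def comp (s t : List Nat) : List Nat := t.map (ap s)

/-- the inverse permutation -/
def inv (t : List Nat) : List Nat := (List.range 4).map (fun y => ((List.range 4).filter (fun x => ap t x == y)).headD 0)

/-- the rotation `r = (c₀ c₁ c₂ c₃)` -/
def r : List Nat := [1, 2, 3, 0]

/-- the reflection `s = (c₁ c₃)`: `K = F^⟨s⟩` -/
def s : List Nat := [0, 3, 2, 1]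

/-- the identity -/
def e : List Nat := [0, 1, 2, 3]

/-- `rs` -/
def rs : List Nat := comp r s

/-- `ι = r²` -/
def iota : List Nat := comp r r

/-- `D₄` as the eight permutations `e, r, r², r³, s, rs, r²s, r³s` -/
def D4 : List (List Nat) :=
  [e, r, comp r r, comp r (comp r r), s, rs, comp r rs, comp r (comp r rs)]

/-- the coset `g⟨rs⟩` as the canonical list of its two elements -/
def cosetRS (g : List Nat) : List (List Nat) := D4.filter (fun h => h == g || h == comp g rs)

/-- the coset `g⟨r³s⟩` -/
def cosetR3S (g : List Nat) : List (List Nat) := D4.filter (fun h => h == g || h == comp g (comp r (comp r rs)))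

/-- the elements of `D₄` over the coset of `c_i`: the `g` with `g·c₀ = c_i` -/
def overCoset (i : Nat) : List (List Nat) := D4.filter (fun g => ap g 0 == i)

/-- the reflex type `Φ* = {⟨rs⟩, s⟨rs⟩}` as a list of cosets -/
def PhiStar : List (List (List Nat)) := [cosetRS e, cosetRS s]

/-- the type `rΦ* = {r⟨rs⟩, rs⟨rs⟩}` of `A′*` -/
def rPhiStar : List (List (List Nat)) := [cosetRS r, cosetRS rs]

/-- the K-signature of the square of a K*-surface of type `Ψ*` with `K` acting through `F`: over each coset of `⟨s⟩`, the number of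
`g` with `g⟨rs⟩ ∈ Ψ*` -/
def sigK (PsiStar : List (List (List Nat))) : List Nat :=
  (List.range 4).map (fun i => ((overCoset i).filter (fun g => PsiStar.elem (cosetRS g))).length)

/-- the K-signature of `A × A′`: `|Φ ∩ x| + |Φ′ ∩ x|` over the cosets `x = c_i` (`Φ = {c₀, c₁}`, `Φ′ = {c₀, c₃}`) -/
def sigAA : List Nat := (List.range 4).map (fun i => (if [0, 1].elem i then 1 else 0) + (if [0, 3].elem i then 1 else 0))

/-- a CM type of `F`: a 4-element sublist of `D₄` containing no pair `{g, ι g}` -/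
def isCMType (P : List (List Nat)) : Bool := P.length == 4 && P.all (fun g => !(P.elem (comp iota g)))

/-- the multiplicities of `P` over the cosets of `⟨s⟩` -/
def mults (P : List (List Nat)) : List Nat := (List.range 4).map (fun i => ((overCoset i).filter (fun g => P.elem g)).length)

/-- `P` is a union of left cosets of the subgroup `{e, h}` -/
def inducedFrom (P : List (List Nat)) (h : List Nat) : Bool := P.all (fun g => P.elem (comp g h))

/-- the canonical form of a subset of `D₄` (in the order of `D4`) -/
def canon (P : List (List Nat)) : List (List Nat) := D4.filter (fun g => P.elem g)

/-- (M1): `B₀ = A* × A*` with `K` through `F` has K-signature `(2,1,0,1)` = the K-signature of `A × A′` -/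
theorem M1_signature : sigK PhiStar = [2, 1, 0, 1] ∧ sigAA = [2, 1, 0, 1] := by decide

/-- (M4): `A′* × A′*` has K-signature `(1, 2, 1, 0)`: the conjugate curve -/
theorem M4_conjugate : sigK rPhiStar = [1, 2, 1, 0] := by decide

/-- (M3): the CM types of `F` with multiplicities `(2,1,0,1)` are exactly `Ψ₂ = ⟨rs⟩ ∪ s⟨rs⟩` and `Ψ₁ = ⟨r³s⟩ ∪ s⟨r³s⟩`, with `Ψ₁ · s = Ψ₂` -/
theorem M3_types :
    ((D4.sublistsLen 4).filter (fun P => isCMType P && mults P == [2, 1, 0, 1])).map canon =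
      [canon (cosetRS e ++ cosetRS s), canon (cosetR3S e ++ cosetR3S s)] ∧
    inducedFrom (cosetRS e ++ cosetRS s) rs = true ∧
    inducedFrom (cosetR3S e ++ cosetR3S s) (comp r (comp r rs)) = true ∧
    canon ((cosetR3S e ++ cosetR3S s).map (fun g => comp g s)) = canon (cosetRS e ++ cosetRS s) := by decide

/-- (M3) transport: pre-composition by `r⁻¹` carries the cosets `⟨r³s⟩, s⟨r³s⟩` to `s⟨rs⟩, ⟨rs⟩` — the type `Φ*`; and `r` conjugates
`⟨r³s⟩` to `⟨rs⟩` -/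
theorem M3_transport :
    cosetRS (comp e (inv r)) = cosetRS s ∧ cosetRS (comp s (inv r)) = cosetRS e ∧
    comp r (comp (comp r (comp r rs)) (inv r)) = rs := by decide

end HodgeRepro0.P2D4ShimuraPoint
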